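import Summits.RiemannHypothesis.RiemannHypothesis.Theorems.EtaLeadingQuarterWeakLockingLayerZeroSideMid

/-!
# Real Dirichlet polynomials at the zeros of `ζ`, III: dyadic middle range (regime (Z4) of
BRIEF-L18-K1 for `EtaLeadingSecondMoment`, stmt-RiemannHypothesis-21791; RH-free)

`midRange_le` (part II) bounds `∑_{X<|γ|≤T₂} m γ^{-2}‖D_a(γ)‖²` with the crude factor `X^{-2}·T₂`;
summing it over dyadic blocks `(2^j X, 2^{j+1} X]` gives, for `X ≥ M`,
`∑_{X < |γ| ≤ 2^K X} m γ^{-2} ‖D_a(γ)‖² ≤ 264 A log(2^K X + 4) (3/2 + (log M)²/2) (∑ a_k²) / X`,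
i.e. the large heights `|γ| > X = M (log M)^5` contribute `o(log M)` to `M · Z(a)` when
`∑ a_k² ≍ log M` (the sharp eta vector). All proved, RH-free. Nothing here bears on the truth of RH.
-/

noncomputable section

open Complex MeasureTheory Set Filter Finset intervalIntegral
open scoped Real Topology ComplexConjugate

set_option linter.dupNamespace false  -- the mandated namespace repeats `RiemannHypothesis`

namespace Summit.RiemannHypothesis.RiemannHypothesis.Theorems.EtaLeadingQuarter.ZeroSide

open Literature.NumberTheory.LFunctions NicolasJExplicit SchoenfeldBound ZetaZeroTails

/-- One dyadic block `(T, 2T]` with `T ≥ M`, `T ≥ 2`: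
`∑_{T<|γ|≤2T} m γ^{-2}‖D_a(γ)‖² ≤ 132 A log(2T+4) (3/2 + (log M)²/2) (∑ a_k²) / T`. [folklore] -/
theorem dyadicBlock_le {A : ℝ} (hA0 : 0 ≤ A)
    (hA : ∀ t : ℝ, 0 ≤ t → (zetaZeroCount (t + 1) : ℝ) - zetaZeroCount t ≤ A * Real.log (t + 2))
    (a : ℕ → ℝ) (M : ℕ) {T : ℝ} (hT : 2 ≤ T) (hTM : (M : ℝ) ≤ T) :
    ∑ ρ ∈ zerosUpTo (2 * T) \ zerosUpTo T,
        (riemannZetaZeroOrder (ρ : ℂ) : ℝ) / (ρ : ℂ).im ^ 2 * ‖dirPoly a M (ρ : ℂ).im‖ ^ 2 ≤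
      132 * A * Real.log (2 * T + 4) * ((3 / 2 + Real.log M ^ 2 / 2) * ∑ k ∈ Finset.Icc 1 M, a k ^ 2) / T := by
  have h := midRange_le hA0 hA a M hT (by linarith : T ≤ 2 * T)
  refine h.trans ?_
  have hT0 : 0 < T := by linarith
  have hlog : 0 ≤ Real.log (2 * T + 4) := Real.log_nonneg (by linarith)
  have hQ : 0 ≤ (3 / 2 + Real.log M ^ 2 / 2) * ∑ k ∈ Finset.Icc 1 M, a k ^ 2 := by
    have : 0 ≤ ∑ k ∈ Finset.Icc 1 M, a k ^ 2 := Finset.sum_nonneg fun k _ ↦ sq_nonneg _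
    positivity
  have h33 : 5 * (2 * T + 1) + 18 * (M : ℝ) ≤ 33 * T := by linarith
  calc 2 * (T ^ 2)⁻¹ * (2 * A * Real.log (2 * T + 4)) *
        ((5 * (2 * T + 1) + 18 * M) * ((3 / 2 + Real.log M ^ 2 / 2) * ∑ k ∈ Finset.Icc 1 M, a k ^ 2))
      ≤ 2 * (T ^ 2)⁻¹ * (2 * A * Real.log (2 * T + 4)) *
        ((33 * T) * ((3 / 2 + Real.log M ^ 2 / 2) * ∑ k ∈ Finset.Icc 1 M, a k ^ 2)) := by
        gcongr
    _ = _ := by field_simp; ring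

/-- **Dyadic middle range.** For `X ≥ max(2, M)` and every `K`:
`∑_{X<|γ|≤2^K X} m γ^{-2}‖D_a(γ)‖² ≤ 264 A log(2^K X + 4) (3/2 + (log M)²/2) (∑ a_k²) / X`. [folklore] -/
theorem dyadicRange_le {A : ℝ} (hA0 : 0 ≤ A)
    (hA : ∀ t : ℝ, 0 ≤ t → (zetaZeroCount (t + 1) : ℝ) - zetaZeroCount t ≤ A * Real.log (t + 2))
    (a : ℕ → ℝ) (M : ℕ) {X : ℝ} (hX : 2 ≤ X) (hXM : (M : ℝ) ≤ X) (K : ℕ) :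
    ∑ ρ ∈ zerosUpTo (2 ^ K * X) \ zerosUpTo X,
        (riemannZetaZeroOrder (ρ : ℂ) : ℝ) / (ρ : ℂ).im ^ 2 * ‖dirPoly a M (ρ : ℂ).im‖ ^ 2 ≤
      264 * A * Real.log (2 ^ K * X + 4) * ((3 / 2 + Real.log M ^ 2 / 2) * ∑ k ∈ Finset.Icc 1 M, a k ^ 2) / X *
        (1 - (1 / 2) ^ K) := by
  classical
  set Q : ℝ := (3 / 2 + Real.log M ^ 2 / 2) * ∑ k ∈ Finset.Icc 1 M, a k ^ 2 with hQdef
  have hQ : 0 ≤ Q := by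
    have : 0 ≤ ∑ k ∈ Finset.Icc 1 M, a k ^ 2 := Finset.sum_nonneg fun k _ ↦ sq_nonneg _
    rw [hQdef]; positivity
  have hX0 : 0 < X := by linarith
  set f : Zeros → ℝ := fun ρ ↦
    (riemannZetaZeroOrder (ρ : ℂ) : ℝ) / (ρ : ℂ).im ^ 2 * ‖dirPoly a M (ρ : ℂ).im‖ ^ 2 with hf
  have hf0 : ∀ ρ, 0 ≤ f ρ := fun ρ ↦ mul_nonneg (zeroOrder_div_im_sq_nonneg ρ) (sq_nonneg _)
  induction K with
  | zero => simp
  | succ K ih =>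
    have hpow : (1 : ℝ) ≤ 2 ^ K := one_le_pow₀ (by norm_num)
    have hT : 2 ≤ 2 ^ K * X := by nlinarith
    have hTM : (M : ℝ) ≤ 2 ^ K * X := by nlinarith
    -- split the range at `2^K X`
    have hsub1 : zerosUpTo X ⊆ zerosUpTo (2 ^ K * X) := zerosUpTo_subset (by nlinarith)
    have hsub2 : zerosUpTo (2 ^ K * X) ⊆ zerosUpTo (2 ^ (K + 1) * X) :=
      zerosUpTo_subset (by rw [pow_succ]; nlinarith)
    have hsplit : ∑ ρ ∈ zerosUpTo (2 ^ (K + 1) * X) \ zerosUpTo X, f ρ =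
        ∑ ρ ∈ zerosUpTo (2 ^ (K + 1) * X) \ zerosUpTo (2 ^ K * X), f ρ +
          ∑ ρ ∈ zerosUpTo (2 ^ K * X) \ zerosUpTo X, f ρ := by
      rw [← Finset.sum_union]
      · congr 1
        ext ρ
        simp only [Finset.mem_sdiff, Finset.mem_union]
        constructor
        · rintro ⟨h1, h2⟩
          by_cases h3 : ρ ∈ zerosUpTo (2 ^ K * X)
          · exact Or.inr ⟨h3, h2⟩
          · exact Or.inl ⟨h1, h3⟩
        · rintro (⟨h1, h2⟩ | ⟨h1, h2⟩)
          · exact ⟨h1, fun h ↦ h2 (hsub1 h)⟩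
          · exact ⟨hsub2 h1, h2⟩
      · rw [Finset.disjoint_left]
        rintro ρ h1 h2
        rw [Finset.mem_sdiff] at h1 h2
        exact h1.2 h2.1
    have hblock := dyadicBlock_le hA0 hA a M hT hTM
    rw [show 2 * (2 ^ K * X) = 2 ^ (K + 1) * X by rw [pow_succ]; ring] at hblock
    rw [hsplit]
    -- monotonicity of the logarithm in `K`
    have hlogK : Real.log (2 ^ K * X + 4) ≤ Real.log (2 ^ (K + 1) * X + 4) :=
      Real.log_le_log (by positivity) (by rw [pow_succ]; nlinarith)
    have hlog0 : 0 ≤ Real.log (2 ^ K * X + 4) := Real.log_nonneg (by nlinarith)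
    have hlog1 : 0 ≤ Real.log (2 ^ (K + 1) * X + 4) := hlog0.trans hlogK
    have ih' : ∑ ρ ∈ zerosUpTo (2 ^ K * X) \ zerosUpTo X, f ρ ≤
        264 * A * Real.log (2 ^ (K + 1) * X + 4) * Q / X * (1 - (1 / 2) ^ K) := by
      refine ih.trans ?_
      have h1 : 0 ≤ 1 - (1 / 2 : ℝ) ^ K := by
        have : (1 / 2 : ℝ) ^ K ≤ 1 := pow_le_one₀ (by norm_num) (by norm_num)
        linarith
      have h2 : 264 * A * Real.log (2 ^ K * X + 4) * Q / X ≤ 264 * A * Real.log (2 ^ (K + 1) * X + 4) * Q / X := by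
        apply div_le_div_of_nonneg_right _ hX0.le
        exact mul_le_mul_of_nonneg_right (mul_le_mul_of_nonneg_left hlogK (by positivity)) hQ
      exact mul_le_mul_of_nonneg_right h2 h1
    have hblock' : 132 * A * Real.log (2 ^ (K + 1) * X + 4) * Q / (2 ^ K * X) =
        264 * A * Real.log (2 ^ (K + 1) * X + 4) * Q / X * ((1 / 2) ^ K / 2) := by
      rw [div_pow, one_pow]
      field_simp
      ring
    have hgeom : (1 - (1 / 2 : ℝ) ^ K) + (1 / 2) ^ K / 2 = 1 - (1 / 2) ^ (K + 1) := by ring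
    calc ∑ ρ ∈ zerosUpTo (2 ^ (K + 1) * X) \ zerosUpTo (2 ^ K * X), f ρ +
          ∑ ρ ∈ zerosUpTo (2 ^ K * X) \ zerosUpTo X, f ρ
        ≤ 132 * A * Real.log (2 ^ (K + 1) * X + 4) * Q / (2 ^ K * X) +
          264 * A * Real.log (2 ^ (K + 1) * X + 4) * Q / X * (1 - (1 / 2) ^ K) := add_le_add hblock ih'
      _ = 264 * A * Real.log (2 ^ (K + 1) * X + 4) * Q / X * (1 - (1 / 2) ^ (K + 1)) := by
          rw [hblock', ← hgeom]; ring

/-- **Regime (Z4), packaged.** For `X ≥ max(2, M)` and `K`: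
`∑_{X<|γ|≤2^K X} m γ^{-2}‖D_a(γ)‖² ≤ 264 A log(2^K X + 4) (3/2 + (log M)²/2) (∑ a_k²) / X`. [folklore] -/
theorem dyadicRange_le' {A : ℝ} (hA0 : 0 ≤ A)
    (hA : ∀ t : ℝ, 0 ≤ t → (zetaZeroCount (t + 1) : ℝ) - zetaZeroCount t ≤ A * Real.log (t + 2))
    (a : ℕ → ℝ) (M : ℕ) {X : ℝ} (hX : 2 ≤ X) (hXM : (M : ℝ) ≤ X) (K : ℕ) :
    ∑ ρ ∈ zerosUpTo (2 ^ K * X) \ zerosUpTo X,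
        (riemannZetaZeroOrder (ρ : ℂ) : ℝ) / (ρ : ℂ).im ^ 2 * ‖dirPoly a M (ρ : ℂ).im‖ ^ 2 ≤
      264 * A * Real.log (2 ^ K * X + 4) * ((3 / 2 + Real.log M ^ 2 / 2) * ∑ k ∈ Finset.Icc 1 M, a k ^ 2) / X := by
  refine (dyadicRange_le hA0 hA a M hX hXM K).trans ?_
  have hQ : 0 ≤ (3 / 2 + Real.log M ^ 2 / 2) * ∑ k ∈ Finset.Icc 1 M, a k ^ 2 := by
    have : 0 ≤ ∑ k ∈ Finset.Icc 1 M, a k ^ 2 := Finset.sum_nonneg fun k _ ↦ sq_nonneg _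
    positivity
  have hlog : 0 ≤ Real.log (2 ^ K * X + 4) := Real.log_nonneg (by
    have : (1 : ℝ) ≤ 2 ^ K := one_le_pow₀ (by norm_num); nlinarith)
  have h0 : 0 ≤ 264 * A * Real.log (2 ^ K * X + 4) *
      ((3 / 2 + Real.log M ^ 2 / 2) * ∑ k ∈ Finset.Icc 1 M, a k ^ 2) / X := by
    apply div_nonneg _ (by linarith); positivity
  have h1 : 1 - (1 / 2 : ℝ) ^ K ≤ 1 := by
    have : 0 ≤ (1 / 2 : ℝ) ^ K := by positivity
    linarith
  exact (mul_le_mul_of_nonneg_left h1 h0).trans_eq (mul_one _)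

end Summit.RiemannHypothesis.RiemannHypothesis.Theorems.EtaLeadingQuarter.ZeroSide

end
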